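import Summits.AtomisticToContinuum.Crystallization.Theorems.FrustratedLawDichotomyCoherentSets

/-!
# Crux `AperiodicFrustratedLawGap` — WINDOW INDEXING of a coherent hard-core configuration (lens-5 NODE-13; T2 glue)

Route `FrustratedLawDichotomy`, residual crux `AperiodicFrustratedLawGap` (item `stmt-AtomisticToContinuum-27623`), reading A′,
energy side (`hdef`), architecture HDEF-ARCH-g111 §5/§8bis/§9.  The class-A cell certificate (NODE-9 `…AdjointCertificate`, NODE-10
`…ForceRemainder`, NODE-11 `…WindowSymmetry`, NODE-12 `…EnergyRemainder`) is a statement about FINITE, TEMPLATE-INDEXED families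
of atoms `q_x ∈ closedBall x τ`, `x ∈ a`.  The configurations of the crux are counting measures `count.restrict S` of `δ`-separated sets
`S ∋ 0` (`IsRootedHardCore`), and class A is membership in the coherent set `coherentAt a τ R` of (189) `…CoherentSets`.  This file is
the dictionary between the two:

* `atomOf S τ x` — THE atom of `S` in the template ball `closedBall x τ` (junk `0` when the ball is empty); under `2τ < δ` it is the
  unique one (`eq_atomOf_of_mem`), it lies within `τ` of `x` (`dist_atomOf_le`, `norm_atomOf_le`), the root is its own atom
  (`atomOf_zero`), and on a template whose points are `> 2τ` apart the map `x ↦ atomOf S τ x` is injective (`injOn_atomOf`);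
* `inter_closedBall_subset_image_atomOf` / `inter_closedBall_eq_image_atomOf` — the window's atoms `S ∩ closedBall 0 R` are (exactly, when
  every template ball fits inside the window, `‖x‖ + τ ≤ R`) the template-indexed atoms `atomOf S τ '' a`; hence the window is finite with
  `a.card` atoms (`ncard_inter_closedBall_eq`);
* `restrict_closedBall_eq_count_image` and **`setIntegral_closedBall_eq_sum_atomOf`** — `∫ z in closedBall 0 R, f z ∂(count.restrict S)
  = ∑ x ∈ a, f (atomOf S τ x)` for EVERY `f` (no integrability needed): the truncated root energy, the truncated force and every other
  window functional of the certificate is a template-indexed finite sum;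
* `sub_lt_dist_of_not_mem_closedBall` — atoms outside the window are at distance `> R − ‖p‖` from a point `p` of norm `≤ ‖p‖`: the far
  field seen by an interior atom starts at `R − R_A − τ` (the `d = Rc − |n_k|` of HDEF-ARCH §9's far column).

Mathlib + (189) only; one definition (`atomOf`), no `sorry`.
-/

noncomputable section

namespace Summit.AtomisticToContinuum.Crystallization.Theorems.FrustratedLawDichotomyCoherentWindow

open MeasureTheory Metric Set
open Summit.AtomisticToContinuum.Crystallization.Theorems.ChargedEnergyGapNegative (E3)
open Summit.AtomisticToContinuum.Crystallization.Theorems.FrustratedLawDichotomyCoherentSets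
  (coherentAt count_restrict_mem_coherentAt_iff count_restrict_mem_coherentAt_iff' subsingleton_closedBall_inter_of_separated)

open Classical in
/-- **The atom of `S` in the template ball around `x`**: some point of `closedBall x τ ∩ S` when there is one, junk `0` otherwise. -/
def atomOf (S : Set E3) (τ : ℝ) (x : E3) : E3 :=
  if h : (closedBall x τ ∩ S).Nonempty then h.some else 0

variable {S : Set E3} {δ τ R : ℝ} {a : Finset E3}

/-- Specification: if the ball meets `S`, `atomOf S τ x` is an atom of `S` in the ball. [folklore] -/
theorem atomOf_mem {x : E3} (h : (closedBall x τ ∩ S).Nonempty) : atomOf S τ x ∈ closedBall x τ ∩ S := by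
  classical
  rw [atomOf, dif_pos h]
  exact h.some_mem

/-- Uniqueness: in a `δ`-separated `S` with `2τ < δ`, every atom of the ball IS `atomOf S τ x`. [folklore] -/
theorem eq_atomOf_of_mem (hS : ∀ p ∈ S, ∀ p' ∈ S, p ≠ p' → δ ≤ dist p p') (hτ : 2 * τ < δ) {x p : E3}
    (hp : p ∈ closedBall x τ ∩ S) : p = atomOf S τ x :=
  subsingleton_closedBall_inter_of_separated hS hτ x hp (atomOf_mem ⟨p, hp⟩)

/-- The atom lies within `τ` of its template point. [folklore] -/
theorem dist_atomOf_le {x : E3} (h : (closedBall x τ ∩ S).Nonempty) : dist (atomOf S τ x) x ≤ τ :=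
  mem_closedBall.1 (atomOf_mem h).1

/-- … hence has norm at most `‖x‖ + τ`. [folklore] -/
theorem norm_atomOf_le {x : E3} (h : (closedBall x τ ∩ S).Nonempty) : ‖atomOf S τ x‖ ≤ ‖x‖ + τ := by
  have h1 : ‖atomOf S τ x - x‖ ≤ τ := by rw [← dist_eq_norm]; exact dist_atomOf_le h
  calc ‖atomOf S τ x‖ = ‖x + (atomOf S τ x - x)‖ := by rw [add_sub_cancel]
    _ ≤ ‖x‖ + ‖atomOf S τ x - x‖ := norm_add_le _ _
    _ ≤ ‖x‖ + τ := add_le_add le_rfl h1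

/-- The displacement `atomOf S τ x − x` has norm at most `τ` (the `‖δ_k‖ ≤ τ` slot of NODE-9/10/12). [folklore] -/
theorem norm_atomOf_sub_le {x : E3} (h : (closedBall x τ ∩ S).Nonempty) : ‖atomOf S τ x - x‖ ≤ τ := by
  rw [← dist_eq_norm]; exact dist_atomOf_le h

/-- **The root is its own atom**: `0 ∈ S`, `0 ≤ τ`, `2τ < δ` give `atomOf S τ 0 = 0`. [folklore] -/
theorem atomOf_zero (hS : ∀ p ∈ S, ∀ p' ∈ S, p ≠ p' → δ ≤ dist p p') (hτ : 2 * τ < δ) (h0 : (0 : E3) ∈ S) (hτ0 : 0 ≤ τ) :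
    atomOf S τ 0 = 0 :=
  (eq_atomOf_of_mem hS hτ ⟨mem_closedBall_self hτ0, h0⟩).symm

/-- Under coherence every template ball meets `S`, so `atomOf` is specified on the whole template. [folklore] -/
theorem nonempty_of_mem_coherentAt (h : (Measure.count.restrict S : Measure E3) ∈ coherentAt a τ R) {x : E3} (hx : x ∈ a) :
    (closedBall x τ ∩ S).Nonempty :=
  ((count_restrict_mem_coherentAt_iff S a τ R).1 h).1 x hx

/-- `atomOf` on a coherent template: an atom of `S` within `τ` of each template point. [folklore] -/
theorem atomOf_mem_of_mem_coherentAt (h : (Measure.count.restrict S : Measure E3) ∈ coherentAt a τ R) {x : E3} (hx : x ∈ a) :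
    atomOf S τ x ∈ closedBall x τ ∩ S :=
  atomOf_mem (nonempty_of_mem_coherentAt h hx)

/-- **Injectivity on the template**: if the template points are pairwise `> 2τ` apart and every template ball meets `S`, distinct
template points have distinct atoms. [folklore] -/
theorem injOn_atomOf (ha : ∀ x ∈ a, ∀ x' ∈ a, x ≠ x' → 2 * τ < dist x x') (hne : ∀ x ∈ a, (closedBall x τ ∩ S).Nonempty) :
    Set.InjOn (atomOf S τ) a := by
  intro x hx x' hx' hxx'
  by_contra hne'
  have h1 := dist_atomOf_le (hne x hx)
  have h2 := dist_atomOf_le (hne x' hx')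
  have h3 : dist x x' ≤ τ + τ := by
    calc dist x x' ≤ dist x (atomOf S τ x) + dist (atomOf S τ x) x' := dist_triangle _ _ _
      _ ≤ τ + τ := add_le_add (by rw [dist_comm]; exact h1) (by rw [hxx']; exact h2)
  have := ha x hx x' hx' hne'
  linarith

/-- The template-indexed atoms are atoms. [folklore] -/
theorem image_atomOf_subset (hne : ∀ x ∈ a, (closedBall x τ ∩ S).Nonempty) : (atomOf S τ '' (a : Set E3)) ⊆ S := by
  rintro _ ⟨x, hx, rfl⟩
  exact (atomOf_mem (hne x hx)).2

/-- **Window ⊆ template atoms**: on a coherent window of a separated configuration, every atom of `closedBall 0 R` is the atom of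
some template ball. [folklore] -/
theorem inter_closedBall_subset_image_atomOf (hS : ∀ p ∈ S, ∀ p' ∈ S, p ≠ p' → δ ≤ dist p p') (hτ : 2 * τ < δ)
    (h : (Measure.count.restrict S : Measure E3) ∈ coherentAt a τ R) :
    S ∩ closedBall (0 : E3) R ⊆ atomOf S τ '' (a : Set E3) := by
  intro p hp
  have hcov := ((count_restrict_mem_coherentAt_iff' S a τ R).1 h).2 hp
  simp only [mem_iUnion, exists_prop] at hcov
  obtain ⟨x, hx, hpx⟩ := hcov
  exact ⟨x, hx, (eq_atomOf_of_mem hS hτ ⟨hpx, hp.1⟩).symm⟩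

/-- **Window = template atoms** when every template ball fits inside the window (`‖x‖ + τ ≤ R` for `x ∈ a`). [folklore] -/
theorem inter_closedBall_eq_image_atomOf (hS : ∀ p ∈ S, ∀ p' ∈ S, p ≠ p' → δ ≤ dist p p') (hτ : 2 * τ < δ)
    (h : (Measure.count.restrict S : Measure E3) ∈ coherentAt a τ R) (hin : ∀ x ∈ a, ‖x‖ + τ ≤ R) :
    S ∩ closedBall (0 : E3) R = atomOf S τ '' (a : Set E3) := by
  refine (inter_closedBall_subset_image_atomOf hS hτ h).antisymm ?_
  rintro _ ⟨x, hx, rfl⟩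
  have hm := atomOf_mem_of_mem_coherentAt h (Finset.mem_coe.1 hx)
  exact ⟨hm.2, mem_closedBall_zero_iff.2 ((norm_atomOf_le ⟨_, hm⟩).trans (hin x (Finset.mem_coe.1 hx)))⟩

/-- The same with the image written as a `Finset`. [folklore] -/
theorem inter_closedBall_eq_coe_image (hS : ∀ p ∈ S, ∀ p' ∈ S, p ≠ p' → δ ≤ dist p p') (hτ : 2 * τ < δ)
    (h : (Measure.count.restrict S : Measure E3) ∈ coherentAt a τ R) (hin : ∀ x ∈ a, ‖x‖ + τ ≤ R) :
    S ∩ closedBall (0 : E3) R = ((a.image (atomOf S τ) : Finset E3) : Set E3) := by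
  classical
  rw [Finset.coe_image]
  exact inter_closedBall_eq_image_atomOf hS hτ h hin

/-- **The window is finite with exactly `a.card` atoms.** [folklore] -/
theorem ncard_inter_closedBall_eq (hS : ∀ p ∈ S, ∀ p' ∈ S, p ≠ p' → δ ≤ dist p p') (hτ : 2 * τ < δ)
    (h : (Measure.count.restrict S : Measure E3) ∈ coherentAt a τ R) (hin : ∀ x ∈ a, ‖x‖ + τ ≤ R)
    (ha : ∀ x ∈ a, ∀ x' ∈ a, x ≠ x' → 2 * τ < dist x x') :
    (S ∩ closedBall (0 : E3) R).ncard = a.card := by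
  classical
  rw [inter_closedBall_eq_coe_image hS hτ h hin, Set.ncard_coe_finset,
    Finset.card_image_of_injOn (injOn_atomOf ha fun x hx => nonempty_of_mem_coherentAt h hx)]

/-- **The configuration restricted to the window is the counting measure of the template-indexed atoms.** [folklore] -/
theorem restrict_closedBall_eq_count_image (hS : ∀ p ∈ S, ∀ p' ∈ S, p ≠ p' → δ ≤ dist p p') (hτ : 2 * τ < δ)
    (h : (Measure.count.restrict S : Measure E3) ∈ coherentAt a τ R) (hin : ∀ x ∈ a, ‖x‖ + τ ≤ R) :
    (Measure.count.restrict S : Measure E3).restrict (closedBall (0 : E3) R) =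
      Measure.count.restrict (((a.image (atomOf S τ) : Finset E3) : Set E3)) := by
  classical
  rw [Measure.restrict_restrict measurableSet_closedBall, Set.inter_comm, inter_closedBall_eq_coe_image hS hτ h hin]

/-- **WINDOW FUNCTIONALS ARE TEMPLATE SUMS.**  For every `f : E3 → ℝ` (no measurability or integrability needed),
`∫ z in closedBall 0 R, f z ∂(count.restrict S) = ∑ x ∈ a, f (atomOf S τ x)`. [folklore] -/
theorem setIntegral_closedBall_eq_sum_atomOf (hS : ∀ p ∈ S, ∀ p' ∈ S, p ≠ p' → δ ≤ dist p p') (hτ : 2 * τ < δ)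
    (h : (Measure.count.restrict S : Measure E3) ∈ coherentAt a τ R) (hin : ∀ x ∈ a, ‖x‖ + τ ≤ R)
    (ha : ∀ x ∈ a, ∀ x' ∈ a, x ≠ x' → 2 * τ < dist x x') (f : E3 → ℝ) :
    ∫ z in closedBall (0 : E3) R, f z ∂(Measure.count.restrict S : Measure E3) = ∑ x ∈ a, f (atomOf S τ x) := by
  classical
  rw [restrict_closedBall_eq_count_image hS hτ h hin,
    Literature.MathematicalPhysics.StatisticalMechanics.integral_count_restrict_coe_finset,
    Finset.sum_image fun x hx x' hx' hxx' => injOn_atomOf ha (fun y hy => nonempty_of_mem_coherentAt h hy) hx hx' hxx']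

/-- In particular the TRUNCATED ROOT ENERGY of a class-A root is the template sum `½ ∑_{x ∈ a} V ‖atomOf S τ x‖` (this includes the
root's own junk term `V ‖atomOf S τ 0‖ = V 0` when `0 ∈ a`, exactly as in `rootEnergy_count_restrict_coe_finset`). [folklore] -/
theorem truncated_rootEnergy_eq_sum_atomOf (hS : ∀ p ∈ S, ∀ p' ∈ S, p ≠ p' → δ ≤ dist p p') (hτ : 2 * τ < δ)
    (h : (Measure.count.restrict S : Measure E3) ∈ coherentAt a τ R) (hin : ∀ x ∈ a, ‖x‖ + τ ≤ R)
    (ha : ∀ x ∈ a, ∀ x' ∈ a, x ≠ x' → 2 * τ < dist x x') (V : ℝ → ℝ) :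
    (∫ z in closedBall (0 : E3) R, V ‖z‖ ∂(Measure.count.restrict S : Measure E3)) / 2 = (∑ x ∈ a, V ‖atomOf S τ x‖) / 2 := by
  rw [setIntegral_closedBall_eq_sum_atomOf hS hτ h hin ha]

/-- **Atoms outside the window are far from interior points**: `q ∉ closedBall 0 R` and `‖p‖ ≤ r` give `R − r < dist q p` — the far
field of an interior atom at radius `≤ R_A + τ` starts at `R − R_A − τ` (HDEF-ARCH §9). [folklore] -/
theorem sub_lt_dist_of_not_mem_closedBall {q p : E3} {r : ℝ} (hq : q ∉ closedBall (0 : E3) R) (hp : ‖p‖ ≤ r) : R - r < dist q p := by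
  rw [mem_closedBall_zero_iff, not_le] at hq
  have : ‖q‖ ≤ ‖q - p‖ + ‖p‖ := by
    calc ‖q‖ = ‖(q - p) + p‖ := by rw [sub_add_cancel]
      _ ≤ ‖q - p‖ + ‖p‖ := norm_add_le _ _
  rw [dist_eq_norm]
  linarith

/-- Contrapositive packaging: an atom within `R − r` of an interior point of norm `≤ r` lies in the window. [folklore] -/
theorem mem_closedBall_of_dist_le {q p : E3} {r : ℝ} (hp : ‖p‖ ≤ r) (hd : dist q p ≤ R - r) : q ∈ closedBall (0 : E3) R := by
  by_contra hq
  exact absurd hd (not_le.2 (sub_lt_dist_of_not_mem_closedBall hq hp))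

/-- **Near neighbours of an interior atom are template-indexed**: on a coherent window, an atom `q ∈ S` within `R − r` of a point `p`
with `‖p‖ ≤ r` is `atomOf S τ x` for some `x ∈ a`. [folklore] -/
theorem exists_eq_atomOf_of_dist_le (hS : ∀ p ∈ S, ∀ p' ∈ S, p ≠ p' → δ ≤ dist p p') (hτ : 2 * τ < δ)
    (h : (Measure.count.restrict S : Measure E3) ∈ coherentAt a τ R) {q p : E3} {r : ℝ} (hq : q ∈ S) (hp : ‖p‖ ≤ r)
    (hd : dist q p ≤ R - r) : ∃ x ∈ a, q = atomOf S τ x := by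
  obtain ⟨x, hx, hqx⟩ := inter_closedBall_subset_image_atomOf hS hτ h ⟨hq, mem_closedBall_of_dist_le hp hd⟩
  exact ⟨x, hx, hqx.symm⟩

end Summit.AtomisticToContinuum.Crystallization.Theorems.FrustratedLawDichotomyCoherentWindow

end
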